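import Summits.KontsevichZagierPeriods.KontsevichZagierPeriods.Theorems.UnfoldedStokesLegendreAllModuli

/-!
# `legendre_signatures_special` — F3 / BC5 compiled WITNESS of the rung line `Lines/legendre_signatures.lean`
(crux `CubeKernelStep`, stmt-KontsevichZagierPeriods-17854; G1 forward rung over the floor `LegendreAllModuli`,
seed g1-KontsevichZagierPeriods-3523; planner-fwd-rung-KontsevichZagierPeriods-08-0, 2026-08-17)

The graded family `LegendreSignature s` of `Lines/legendre_signatures.lean` (copied VERBATIM below into the
sub-namespace `…LegendreSignatures.Special`, so that this file elaborates on its own, importing ONLY the floor's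
Theorems file) specialises at the floor parameter `s = 0` to the PROVED floor
`Summit.KontsevichZagierPeriods.KontsevichZagierPeriods.Theses.UnfoldedStokes.LegendreAllModuli`
(stmt-KontsevichZagierPeriods-3523, closed by
`Summit.KontsevichZagierPeriods.UnfoldedStokes.LegendreAllModuliLine.LegendreAllModuli_of` @ e062b17d81a3):
`example : LegendreSignature 0 := by simpa [LegendreSignature, LegendreAllModuli] using LegendreAllModuli_of`
(the weights `(·)^((0:ℚ):ℝ)` are `1` by `Real.rpow_zero`, the constant `2(1+2·0)cos(π·0) = 2`), no `sorry`;
and conversely `LegendreSignature 0 → LegendreAllModuli` by the same `simpa` (the identification is exact).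
rung_decl = `Summit.KontsevichZagierPeriods.KontsevichZagierPeriods.Cruxes.CubeKernelStep.LegendreSignatures.LegendreAllSignatures`
(`∀ s : ℚ, −1/2 < s → s < 1/2 → LegendreSignature s`); witness_regime: quadratic relations among complete
elliptic integrals of the first and second kind at ALL real algebraic moduli (two non-isogenous-in-general curves
`E_k`, `E_{k'}`); S known there: no (in print: Huber–Wüstholz cover 1-dimensional periods only; in tree: only
the ≤ 1-dimensional linear layer `PlanarAreas` modulo the cite-only fact `HuberWustholzCurvePeriods`).
-/

noncomputable section

set_option linter.dupNamespace false

open Literature.NumberTheory.Transcendental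

namespace Summit.KontsevichZagierPeriods.KontsevichZagierPeriods.Cruxes.CubeKernelStep.LegendreSignatures.Special

open Summit.KontsevichZagierPeriods.KontsevichZagierPeriods.Theses.UnfoldedStokes (LegendreAllModuli)
open Summit.KontsevichZagierPeriods.UnfoldedStokes.LegendreAllModuliLine (LegendreAllModuli_of)

/-- Verbatim copy of `LegendreSignatures.LegendreSignature` (the graded family; parameter = signature `s`). -/
def LegendreSignature (s : ℚ) : Prop :=
  ∀ k : ℝ, IsAlgebraic ℚ k → 0 < k → k < 1 →
    ∀ (r : KZ.IntegralRep 2) (r' : KZ.IntegralRep 1),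
      r.domain = {x | ∀ i, x i ∈ Set.Ioo (0 : ℝ) 1} →
      Set.EqOn r.integrand (fun x =>
          (x 0 ^ 2 * (1 - k ^ 2 * x 0 ^ 2) / (1 - x 0 ^ 2)) ^ (s : ℝ) *
              (x 1 ^ 2 * (1 - (1 - k ^ 2) * x 1 ^ 2) / (1 - x 1 ^ 2)) ^ (s : ℝ) *
            (Real.sqrt (1 - k ^ 2 * x 0 ^ 2) / Real.sqrt (1 - x 0 ^ 2) /
              Real.sqrt ((1 - x 1 ^ 2) * (1 - (1 - k ^ 2) * x 1 ^ 2))) +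
          (x 0 ^ 2 * (1 - (1 - k ^ 2) * x 0 ^ 2) / (1 - x 0 ^ 2)) ^ (s : ℝ) *
              (x 1 ^ 2 * (1 - k ^ 2 * x 1 ^ 2) / (1 - x 1 ^ 2)) ^ (s : ℝ) *
            (Real.sqrt (1 - (1 - k ^ 2) * x 0 ^ 2) / Real.sqrt (1 - x 0 ^ 2) /
              Real.sqrt ((1 - x 1 ^ 2) * (1 - k ^ 2 * x 1 ^ 2))) -
          (x 0 ^ 2 * (1 - k ^ 2 * x 0 ^ 2) / (1 - x 0 ^ 2)) ^ (s : ℝ) *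
              (x 1 ^ 2 * (1 - (1 - k ^ 2) * x 1 ^ 2) / (1 - x 1 ^ 2)) ^ (s : ℝ) *
            (1 / Real.sqrt ((1 - x 0 ^ 2) * (1 - k ^ 2 * x 0 ^ 2)) /
              Real.sqrt ((1 - x 1 ^ 2) * (1 - (1 - k ^ 2) * x 1 ^ 2)))) r.domain →
      r'.domain = Set.univ →
      Set.EqOn r'.integrand
        (fun x => 1 / (2 * (1 + 2 * (s : ℝ)) * Real.cos (Real.pi * s) * (1 + x 0 ^ 2))) r'.domain →
      KZ.Equivalent r r'

/-- Verbatim copy of `LegendreSignatures.LegendreAllSignatures` (THE RUNG). -/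
def LegendreAllSignatures : Prop :=
  ∀ s : ℚ, (-1/2 : ℚ) < s → s < 1/2 → LegendreSignature s

/-- F3 (special case = the floor): `Rung`'s family at the floor parameter `s = 0` from the floor decl and
nothing else. -/
example : LegendreSignature 0 := by
  simpa [LegendreSignature, LegendreAllModuli] using LegendreAllModuli_of

/-- The same as a named theorem (for `--witness`). -/
theorem legendreSignature_zero : LegendreSignature 0 := by
  simpa [LegendreSignature, LegendreAllModuli] using LegendreAllModuli_of

/-- Conversely the floor is the family at `0` (so the identification is exact, not a weakening). -/
example (h0 : LegendreSignature 0) : LegendreAllModuli := by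
  simpa [LegendreSignature, LegendreAllModuli] using h0

/-- The rung contains the floor parameter: `LegendreAllSignatures → LegendreAllModuli`. -/
example (h : LegendreAllSignatures) : LegendreAllModuli := by
  have h0 : LegendreSignature 0 := h 0 (by norm_num) (by norm_num)
  simpa [LegendreSignature, LegendreAllModuli] using h0

end Summit.KontsevichZagierPeriods.KontsevichZagierPeriods.Cruxes.CubeKernelStep.LegendreSignatures.Special
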